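import Literature.Analysis.FluidPDE.StationaryEulerLaminateWaves
import Literature.Analysis.FluidPDE.StationaryEulerLaminatesHighDim
import Literature.Analysis.FluidPDE.StationaryEulerTorusBlocks
import Summits.AnomalousDissipation.AnomalousDissipation.Theorems.PointSinkPointFluxConePressurelessPacketTools
import HarnessLib

/-!
# Stub `stub_pressurelessPacket` — pressureless packets (PL → PTS → PPK)
(crux `PointSink.PointFluxCone`, stmt-AnomalousDissipation-19033, line `Sketch`)

Prop. 6 of Choffrut–Székelyhidi 2014 (the tree's `StationaryEuler.realize`, file
`Literature/Analysis/FluidPDE/StationaryEulerLaminateWaves`) WITH a sup bound on the packet pressure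
`prC` (`Literature/Analysis/FluidPDE/StationaryEulerTorusBlocks`): a PRESSURELESS laminate of finite
order (every splitting certificate has `q = 0`) in `𝓛(𝒰)` is realized, for every `ε, δ > 0`, by a
wave packet `P` supported in the reference cube of its frame with `w̄ + P(x) ∈ 𝒰` for all `x`,
`∫ ‖P‖² ≥ Var(ν) - ε` and `|prC P| ≤ δ` everywhere.

Mechanism (`pressurelessPacket_realize`, structural induction as in `realize`).  For a split with
`q = 0` the certificate `certOfSplit` has `S̄ = str (z_r - z_l)`, which is trace free, so the
two-state wave with the trace bound (PTS, hypothesis) gives a top wave term with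
`|Σ_m S[φ₀]_{mm}| ≤ δ/2`, i.e. `|prC [τ₀]| ≤ δ/2`; the children are realized with pressure `≤ δ/4`
(induction) and re-placed as rescaled copies on grid cubes (`placed`), which keeps the sup bound
(`pressurelessPacket_abs_prC_placed_le`, Tools file); `prC` is additive, whence `|prC P| ≤ δ`.  The
supports, the values and the energy are treated verbatim as in `realize`.  Finally PPK follows from
the pressureless laminate property (PL, hypothesis) and Cor. 16 (`Laminate.sub_norm_vel_sq_le_var`).

References: A. Choffrut, L. Székelyhidi Jr., *Weak solutions to the stationary incompressible
Euler equations*, SIAM J. Math. Anal. 46 (2014), Lemma 4, Prop. 6, Cor. 16.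
-/

noncomputable section

open scoped InnerProductSpace ContDiff ENNReal Topology
open Set Function MeasureTheory Metric Filter
open Literature.Analysis.FluidPDE Literature.Analysis.FluidPDE.StationaryEuler
open Literature.Analysis.FunctionSpaces

set_option linter.dupNamespace false

namespace Summit.AnomalousDissipation.AnomalousDissipation.Theorems

/-! ## Prop. 6 with pressure -/

/-- **Prop. 6 with pressure (realization of pressureless laminates of finite order).** Let `𝒰` be a
relatively open set of admissible states and `T` a valid splitting tree in `𝓛(𝒰)` all of whose
certificates have `q = 0`. Given the two-state wave with the trace bound (hypothesis `hTS`), for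
every `ε, δ > 0` there is a wave packet `P` supported in the reference cube of the frame of `T` with
`w̄ + P.field x ∈ 𝒰` for all `x`, `∫ ‖P.field‖² ≥ Var(ν) - ε` and `|prC P x| ≤ δ` for all `x`.
[cite: ChoffrutSzekelyhidi2014, Prop. 6] -/
theorem pressurelessPacket_realize {d : Type*} [Fintype d] [DecidableEq d] [Nonempty d]
    (hTS : ∀ (c : WaveCert d), ‖c.η‖ = 1 → c.S.trace = 0 → ∀ (i₀ : d) (t : ℝ), 0 ≤ t → t ≤ 1 →
      ∀ (ε δ : ℝ), 0 < ε → 0 < δ →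
        ∃ φ : Ed d → ℝ, ContDiff ℝ ∞ φ ∧ HasCompactSupport φ ∧
          tsupport φ ⊆ refCube (houseR i₀ c.η) ∧
          (∀ x, ∃ θ ∈ Icc (-(1 - t)) t, ‖c.field φ x - θ • c.dir‖ ≤ δ) ∧
          (∀ x, |∑ m, c.strS φ m m x| ≤ δ) ∧
          ∃ Al Ar : Set (Ed d), IsOpen Al ∧ IsOpen Ar ∧ Al ⊆ refCube (houseR i₀ c.η) ∧
            Ar ⊆ refCube (houseR i₀ c.η) ∧ Disjoint Al Ar ∧
            (∀ x ∈ Al, c.field φ x = (-(1 - t)) • c.dir) ∧ (∀ x ∈ Ar, c.field φ x = t • c.dir) ∧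
            t - ε ≤ volume.real Al ∧ (1 - t) - ε ≤ volume.real Ar)
    (i₀ : d) {U : Set (State d)} (hUo : IsRelOpen U) (hUA : U ⊆ Adm) (T : Laminate d)
    (hT : T.IsValid U)
    (hT0 : @Laminate.rec d (fun _ => Prop) (fun _ => True)
      (fun _ _ q _ _ ihl ihr => q = 0 ∧ ihl ∧ ihr) T)
    {ε δ : ℝ} (hε : 0 < ε) (hδ : 0 < δ) :
    ∃ P : Packet d, P.SuppIn (refCube (T.frame i₀)) ∧ (∀ x, T.bary + P.field x ∈ U) ∧
      T.var T.bary - ε ≤ ∫ x, ‖P.field x‖ ^ 2 ∧ ∀ x, |P.prC x| ≤ δ := by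
  -- adapted from Literature/Analysis/FluidPDE/StationaryEulerLaminateWaves (realize)
  induction T generalizing ε δ with
  | atom w =>
    refine ⟨[], fun τ hτ => by simp at hτ, fun x => ?_, ?_, fun x => ?_⟩
    · rw [Packet.field_nil, add_zero]; exact hT
    · simp only [Laminate.var_atom, Laminate.bary_atom, sub_self, norm_zero, ne_eq, OfNat.ofNat_ne_zero,
        not_false_eq_true, zero_pow, zero_sub, Packet.field_nil, integral_zero]
      linarith
    · rw [Packet.prC_nil, abs_zero]; exact hδ.le
  | split t η q l r ihl ihr =>
    -- data of the split
    obtain ⟨hq, hl0, hr0⟩ := hT0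
    obtain ⟨ht0, ht1, hη, hvη, huη, hseg, hl, hr⟩ := hT
    have hT : (Laminate.split t η q l r).IsValid U := ⟨ht0, ht1, hη, hvη, huη, hseg, hl, hr⟩
    set zl := l.bary with hzl
    set zr := r.bary with hzr
    set wb := (Laminate.split t η q l r).bary with hwb
    have hzlU : zl ∈ U := hl.bary_mem
    have hzrU : zr ∈ U := hr.bary_mem
    have hadm_l : IsAdm zl := hUA hzlU
    have hadm_r : IsAdm zr := hUA hzrU
    have hadm : IsAdm (zr - zl) := hadm_r.sub hadm_l
    have hwbU : wb ∈ U := hT.bary_mem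
    have hadm_w : IsAdm wb := hUA hwbU
    set c := certOfSplit hT hadm with hc
    have hcdir : c.dir = zr - zl := dir_certOfSplit hT hadm
    have hcη : ‖c.η‖ = 1 := norm_η_certOfSplit hT hadm
    have hctr : c.S.trace = 0 := pressurelessPacket_trace_certOfSplit hT hadm hq
    -- Step 1: the children (tolerance ε/4, pressure δ/4)
    have hε4 : 0 < ε / 4 := by linarith
    have hδ4 : 0 < δ / 4 := by linarith
    obtain ⟨Pl, hPl_supp, hPl_U, hPl_gain, hPl_pr⟩ := ihl hl hl0 hε4 hδ4
    obtain ⟨Pr, hPr_supp, hPr_U, hPr_gain, hPr_pr⟩ := ihr hr hr0 hε4 hδ4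
    set Il := ∫ x, ‖Packet.field Pl x‖ ^ 2 with hIl
    set Ir := ∫ x, ‖Packet.field Pr x‖ ^ 2 with hIr
    have hIl0 : 0 ≤ Il := integral_nonneg fun x => by positivity
    have hIr0 : 0 ≤ Ir := integral_nonneg fun x => by positivity
    set Xl := l.var wb with hXl
    set Xr := r.var wb with hXr
    have hXl0 : 0 ≤ Xl := Laminate.var_nonneg hl.weightsIn _
    have hXr0 : 0 ≤ Xr := Laminate.var_nonneg hr.weightsIn _
    have hXl_eq : Xl = l.var zl + ‖zl - wb‖ ^ 2 := Laminate.var_eq_var_bary_add l wb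
    have hXr_eq : Xr = r.var zr + ‖zr - wb‖ ^ 2 := Laminate.var_eq_var_bary_add r wb
    have hvarT : (Laminate.split t η q l r).var wb = t * Xl + (1 - t) * Xr := Laminate.var_split wb t η q l r
    -- Step 2: the margin of the splitting segment
    have hsegc : IsCompact (segment ℝ zl zr) := by
      rw [segment_eq_image]
      exact isCompact_Icc.image (by fun_prop)
    obtain ⟨δs, hδs, hmarg_s⟩ := hUo.exists_margin hsegc hseg
    -- Step 3: the two-state wave with waste `e`, value tolerance `≤ δs/2` and trace `≤ δ/2`
    set e : ℝ := ε / (8 * (Xl + Xr + 1)) with he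
    have he0 : 0 < e := by positivity
    have heX : e * (Xl + Xr) ≤ ε / 8 := by
      rw [he, div_mul_eq_mul_div, div_le_div_iff₀ (by positivity) (by norm_num)]
      nlinarith
    have hδ' : 0 < min (δs / 2) (δ / 2) := lt_min (half_pos hδs) (half_pos hδ)
    obtain ⟨φ₀, hφ₀s, hφ₀c, hφ₀supp, hvals, htrφ, Al, Ar, hAlo, hAro, hAlB, hArB, hdisj, hWl, hWr, hvolAl,
      hvolAr⟩ := hTS c hcη hctr i₀ t ht0 ht1 e _ he0 hδ'
    set τ₀ : WaveTerm d := ⟨c, φ₀, hφ₀s, hφ₀c⟩ with hτ₀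
    -- Step 4: fill `Al` and `Ar` by cubes of the children's frames
    have hfinAl : volume Al ≠ ⊤ :=
      ne_top_of_le_ne_top (by rw [volume_refCube]; exact ENNReal.one_ne_top) (measure_mono hAlB)
    have hfinAr : volume Ar ≠ ⊤ :=
      ne_top_of_le_ne_top (by rw [volume_refCube]; exact ENNReal.one_ne_top) (measure_mono hArB)
    obtain ⟨ml, hml0, Sl, hSl_sub, hSl_vol⟩ := exists_acubes_subset (R := l.frame i₀) hAlo hfinAl
      (ENNReal.ofReal_pos.2 he0).ne' 0
    obtain ⟨mr, hmr0, Sr, hSr_sub, hSr_vol⟩ := exists_acubes_subset (R := r.frame i₀) hAro hfinAr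
      (ENNReal.ofReal_pos.2 he0).ne' 0
    have hml : 0 < ml := hml0
    have hmr : 0 < mr := hmr0
    have hcubel : ∀ κ ∈ Sl, acube (l.frame i₀) ml κ ⊆ Al := fun κ hκ =>
      (acube_subset_acubeClosed ml κ).trans (hSl_sub κ hκ)
    have hcuber : ∀ κ ∈ Sr, acube (r.frame i₀) mr κ ⊆ Ar := fun κ hκ =>
      (acube_subset_acubeClosed mr κ).trans (hSr_sub κ hκ)
    -- Step 5: the packet
    set P : Packet d := [τ₀] ++ placed (l.frame i₀) hml Sl (fun _ => Pl) ++ placed (r.frame i₀) hmr Sr (fun _ => Pr) with hP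
    have hfield : ∀ x, Packet.field P x = c.field φ₀ x + Packet.field (placed (l.frame i₀) hml Sl (fun _ => Pl)) x +
        Packet.field (placed (r.frame i₀) hmr Sr (fun _ => Pr)) x := fun x => by
      rw [hP, Packet.field_append, Packet.field_append, Packet.field_cons, Packet.field_nil, add_zero]; rfl
    have hcaseA : ∀ κ ∈ Sl, ∀ x ∈ acube (l.frame i₀) ml κ,
        Packet.field P x = (zl - wb) + Packet.field Pl ((ml : ℝ) • (x - corner (l.frame i₀) ml κ)) := by
      intro κ hκ x hx
      have hxAl : x ∈ Al := hcubel κ hκ hx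
      have h1 : c.field φ₀ x = zl - wb := by
        rw [hWl x hxAl, hcdir, hwb, Laminate.bary_split]; module
      have h2 : Packet.field (placed (l.frame i₀) hml Sl (fun _ => Pl)) x =
          Packet.field Pl ((ml : ℝ) • (x - corner (l.frame i₀) ml κ)) :=
        field_placed_of_mem _ hml Sl (fun _ _ => hPl_supp) hκ hx
      have h3 : Packet.field (placed (r.frame i₀) hmr Sr (fun _ => Pr)) x = 0 :=
        field_placed_of_not_mem _ hmr Sr (fun _ _ => hPr_supp) fun κ' hκ' hx' =>
          hdisj.ne_of_mem hxAl (hcuber κ' hκ' hx') rfl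
      rw [hfield, h1, h2, h3, add_zero]
    have hcaseB : ∀ κ ∈ Sr, ∀ x ∈ acube (r.frame i₀) mr κ,
        Packet.field P x = (zr - wb) + Packet.field Pr ((mr : ℝ) • (x - corner (r.frame i₀) mr κ)) := by
      intro κ hκ x hx
      have hxAr : x ∈ Ar := hcuber κ hκ hx
      have h1 : c.field φ₀ x = zr - wb := by
        rw [hWr x hxAr, hcdir, hwb, Laminate.bary_split]; module
      have h2 : Packet.field (placed (l.frame i₀) hml Sl (fun _ => Pl)) x = 0 :=
        field_placed_of_not_mem _ hml Sl (fun _ _ => hPl_supp) fun κ' hκ' hx' =>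
          hdisj.ne_of_mem (hcubel κ' hκ' hx') hxAr rfl
      have h3 : Packet.field (placed (r.frame i₀) hmr Sr (fun _ => Pr)) x =
          Packet.field Pr ((mr : ℝ) • (x - corner (r.frame i₀) mr κ)) :=
        field_placed_of_mem _ hmr Sr (fun _ _ => hPr_supp) hκ hx
      rw [hfield, h1, h2, h3, add_zero]
    refine ⟨P, ?_, fun x => ?_, ?_, fun x => ?_⟩
    · -- supports
      rw [hP, Packet.suppIn_append, Packet.suppIn_append]
      refine ⟨⟨fun τ hτ => ?_, (suppIn_placed _ hml Sl (fun _ _ => hPl_supp)).mono (iUnion₂_subset fun κ hκ =>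
        (hcubel κ hκ).trans hAlB)⟩, (suppIn_placed _ hmr Sr (fun _ _ => hPr_supp)).mono (iUnion₂_subset fun κ hκ =>
        (hcuber κ hκ).trans hArB)⟩
      rw [List.mem_singleton] at hτ
      subst hτ
      exact hφ₀supp
    · -- values in `U`
      have hadmP : IsAdm (wb + Packet.field P x) := hadm_w.add (Packet.isAdm_field P x)
      by_cases hxl : ∃ κ ∈ Sl, x ∈ acube (l.frame i₀) ml κ
      · obtain ⟨κ, hκ, hx⟩ := hxl
        rw [hcaseA κ hκ x hx, ← add_assoc, add_sub_cancel]
        exact hPl_U _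
      by_cases hxr : ∃ κ ∈ Sr, x ∈ acube (r.frame i₀) mr κ
      · obtain ⟨κ, hκ, hx⟩ := hxr
        rw [hcaseB κ hκ x hx, ← add_assoc, add_sub_cancel]
        exact hPr_U _
      · push Not at hxl hxr
        have h2 : Packet.field (placed (l.frame i₀) hml Sl (fun _ => Pl)) x = 0 :=
          field_placed_of_not_mem _ hml Sl (fun _ _ => hPl_supp) hxl
        have h3 : Packet.field (placed (r.frame i₀) hmr Sr (fun _ => Pr)) x = 0 :=
          field_placed_of_not_mem _ hmr Sr (fun _ _ => hPr_supp) hxr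
        rw [hfield, h2, h3, add_zero, add_zero] at hadmP ⊢
        obtain ⟨θ, hθ, hclose⟩ := hvals x
        have hp : wb + θ • (zr - zl) ∈ segment ℝ zl zr := bary_add_smul_mem_segment t η q l r hθ
        refine hmarg_s _ hp _ hadmP ?_
        rw [dist_eq_norm, add_sub_add_left_eq_sub, ← hcdir]
        exact (hclose.trans (min_le_left _ _)).trans_lt (half_lt_self hδs)
    · -- the gain
      have hintP : Integrable fun x => ‖Packet.field P x‖ ^ 2 := integrable_sq_field P
      have hmeas_l : ∀ κ ∈ Sl, MeasurableSet (acube (l.frame i₀) ml κ) := fun κ _ => measurableSet_acube ml κ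
      have hmeas_r : ∀ κ ∈ Sr, MeasurableSet (acube (r.frame i₀) mr κ) := fun κ _ => measurableSet_acube mr κ
      set UL := ⋃ κ ∈ Sl, acube (l.frame i₀) ml κ with hUL
      set UR := ⋃ κ ∈ Sr, acube (r.frame i₀) mr κ with hUR
      have hULAl : UL ⊆ Al := iUnion₂_subset hcubel
      have hURAr : UR ⊆ Ar := iUnion₂_subset hcuber
      have hdisjLR : Disjoint UL UR := hdisj.mono hULAl hURAr
      have hmUL : MeasurableSet UL := MeasurableSet.biUnion Sl.countable_toSet hmeas_l
      have hmUR : MeasurableSet UR := MeasurableSet.biUnion Sr.countable_toSet hmeas_r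
      have hB1 : volume (refCube (houseR i₀ c.η)) = 1 := volume_refCube _
      have hfinB : volume (refCube (houseR i₀ c.η)) ≠ ⊤ := by
        rw [hB1]; exact ENNReal.one_ne_top
      -- energies on the cubes
      have hEl : ∫ x in UL, ‖Packet.field P x‖ ^ 2 =
          Sl.card * (((ml : ℝ)⁻¹) ^ Fintype.card d * (‖zl - wb‖ ^ 2 + Il)) := by
        rw [hUL, integral_biUnion_finset Sl hmeas_l (fun κ _ κ' _ h => disjoint_acube hml h)
          fun κ _ => hintP.integrableOn]
        rw [Finset.sum_congr rfl fun κ hκ => ?_, Finset.sum_const, nsmul_eq_mul]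
        rw [setIntegral_congr_fun (measurableSet_acube ml κ) fun x hx => by rw [hcaseA κ hκ x hx]]
        exact setIntegral_sq_const_add _ hml hPl_supp κ (zl - wb)
      have hEr : ∫ x in UR, ‖Packet.field P x‖ ^ 2 =
          Sr.card * (((mr : ℝ)⁻¹) ^ Fintype.card d * (‖zr - wb‖ ^ 2 + Ir)) := by
        rw [hUR, integral_biUnion_finset Sr hmeas_r (fun κ _ κ' _ h => disjoint_acube hmr h)
          fun κ _ => hintP.integrableOn]
        rw [Finset.sum_congr rfl fun κ hκ => ?_, Finset.sum_const, nsmul_eq_mul]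
        rw [setIntegral_congr_fun (measurableSet_acube mr κ) fun x hx => by rw [hcaseB κ hκ x hx]]
        exact setIntegral_sq_const_add _ hmr hPr_supp κ (zr - wb)
      -- volumes of the cube families
      have hvL : volume.real UL = Sl.card * ((ml : ℝ)⁻¹) ^ Fintype.card d := by
        rw [Measure.real, hUL, volume_biUnion_acube hml, ENNReal.toReal_mul, ENNReal.toReal_natCast,
          ENNReal.toReal_pow, ENNReal.toReal_ofReal (by positivity)]
      have hvR : volume.real UR = Sr.card * ((mr : ℝ)⁻¹) ^ Fintype.card d := by
        rw [Measure.real, hUR, volume_biUnion_acube hmr, ENNReal.toReal_mul, ENNReal.toReal_natCast,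
          ENNReal.toReal_pow, ENNReal.toReal_ofReal (by positivity)]
      have hB1r : volume.real (refCube (houseR i₀ c.η)) = 1 := by
        rw [Measure.real, hB1, ENNReal.toReal_one]
      have hvL1 : volume.real UL ≤ 1 := (measureReal_mono (μ := volume) (hULAl.trans hAlB) hfinB).trans_eq hB1r
      have hvR1 : volume.real UR ≤ 1 := (measureReal_mono (μ := volume) (hURAr.trans hArB) hfinB).trans_eq hB1r
      have hvLge : t - e - e ≤ volume.real UL := by
        have h1 : volume.real Al ≤ volume.real UL + volume.real (Al \ UL) := by
          calc volume.real Al ≤ volume.real (UL ∪ (Al \ UL)) :=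
                measureReal_mono (μ := volume) (fun x hx => by
                  by_cases h : x ∈ UL
                  · exact Or.inl h
                  · exact Or.inr ⟨hx, h⟩) (ne_top_of_le_ne_top hfinAl (measure_mono
                    (union_subset hULAl sdiff_subset)))
            _ ≤ volume.real UL + volume.real (Al \ UL) := measureReal_union_le _ _
        have h2 : volume.real (Al \ UL) ≤ e := ENNReal.toReal_le_of_le_ofReal he0.le hSl_vol.le
        linarith
      have hvRge : (1 - t) - e - e ≤ volume.real UR := by
        have h1 : volume.real Ar ≤ volume.real UR + volume.real (Ar \ UR) := by
          calc volume.real Ar ≤ volume.real (UR ∪ (Ar \ UR)) :=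
                measureReal_mono (μ := volume) (fun x hx => by
                  by_cases h : x ∈ UR
                  · exact Or.inl h
                  · exact Or.inr ⟨hx, h⟩) (ne_top_of_le_ne_top hfinAr (measure_mono
                    (union_subset hURAr sdiff_subset)))
            _ ≤ volume.real UR + volume.real (Ar \ UR) := measureReal_union_le _ _
        have h2 : volume.real (Ar \ UR) ≤ e := ENNReal.toReal_le_of_le_ofReal he0.le hSr_vol.le
        linarith
      -- the total energy dominates the energy on the cubes
      have hsplit : ∫ x in UL ∪ UR, ‖Packet.field P x‖ ^ 2 =
          (∫ x in UL, ‖Packet.field P x‖ ^ 2) + ∫ x in UR, ‖Packet.field P x‖ ^ 2 :=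
        setIntegral_union hdisjLR hmUR hintP.integrableOn hintP.integrableOn
      have hle : ∫ x in UL ∪ UR, ‖Packet.field P x‖ ^ 2 ≤ ∫ x, ‖Packet.field P x‖ ^ 2 :=
        setIntegral_le_integral hintP (Filter.Eventually.of_forall fun x => by positivity)
      -- arithmetic
      have hvL0 : 0 ≤ volume.real UL := measureReal_nonneg
      have hvR0 : 0 ≤ volume.real UR := measureReal_nonneg
      have hYl : Xl - ε / 4 ≤ ‖zl - wb‖ ^ 2 + Il := by rw [hXl_eq]; linarith
      have hYr : Xr - ε / 4 ≤ ‖zr - wb‖ ^ 2 + Ir := by rw [hXr_eq]; linarith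
      have hEl' : volume.real UL * (Xl - ε / 4) ≤ ∫ x in UL, ‖Packet.field P x‖ ^ 2 := by
        rw [hEl, ← mul_assoc, ← hvL]; exact mul_le_mul_of_nonneg_left hYl hvL0
      have hEr' : volume.real UR * (Xr - ε / 4) ≤ ∫ x in UR, ‖Packet.field P x‖ ^ 2 := by
        rw [hEr, ← mul_assoc, ← hvR]; exact mul_le_mul_of_nonneg_left hYr hvR0
      have hkeyl : (t - 2 * e) * Xl - ε / 4 ≤ volume.real UL * (Xl - ε / 4) := by
        have a1 : (t - 2 * e) * Xl ≤ volume.real UL * Xl := mul_le_mul_of_nonneg_right (by linarith) hXl0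
        have a2 : volume.real UL * (ε / 4) ≤ ε / 4 := mul_le_of_le_one_left (by linarith) hvL1
        have a3 : volume.real UL * (Xl - ε / 4) = volume.real UL * Xl - volume.real UL * (ε / 4) := by ring
        linarith
      have hkeyr : ((1 - t) - 2 * e) * Xr - ε / 4 ≤ volume.real UR * (Xr - ε / 4) := by
        have a1 : ((1 - t) - 2 * e) * Xr ≤ volume.real UR * Xr := mul_le_mul_of_nonneg_right (by linarith) hXr0
        have a2 : volume.real UR * (ε / 4) ≤ ε / 4 := mul_le_of_le_one_left (by linarith) hvR1
        have a3 : volume.real UR * (Xr - ε / 4) = volume.real UR * Xr - volume.real UR * (ε / 4) := by ring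
        linarith
      have r1 : (t - 2 * e) * Xl = t * Xl - 2 * (e * Xl) := by ring
      have r2 : ((1 - t) - 2 * e) * Xr = (1 - t) * Xr - 2 * (e * Xr) := by ring
      have r3 : e * (Xl + Xr) = e * Xl + e * Xr := by ring
      rw [hvarT]
      linarith
    · -- the pressure
      have h1 : |Packet.prC [τ₀] x| ≤ δ / 2 :=
        pressurelessPacket_abs_prC_single_le τ₀ x ((htrφ x).trans (min_le_right _ _))
      have h2 : |Packet.prC (placed (l.frame i₀) hml Sl (fun _ => Pl)) x| ≤ δ / 4 :=
        pressurelessPacket_abs_prC_placed_le _ hml Sl (fun _ _ => hPl_supp) hδ4.le (fun _ _ y => hPl_pr y) x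
      have h3 : |Packet.prC (placed (r.frame i₀) hmr Sr (fun _ => Pr)) x| ≤ δ / 4 :=
        pressurelessPacket_abs_prC_placed_le _ hmr Sr (fun _ _ => hPr_supp) hδ4.le (fun _ _ y => hPr_pr y) x
      rw [hP, pressurelessPacket_prC_append, pressurelessPacket_prC_append]
      refine (abs_add_three _ _ _).trans ?_
      linarith

/-! ## The stub -/

/-- **PL → PTS → PPK (pressureless packet at a relaxed state; Prop. 6 with pressure).** For
`w ∈ 𝒰_r` and `ε, δ > 0` there is a wave packet supported in a rotated unit cube with
`w + P(x) ∈ 𝒰_r` for all `x`, energy `∫‖P‖² ≥ r − |v̄|² − ε`, and packet pressure `|prC P| ≤ δ`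
everywhere: realize (`pressurelessPacket_realize`: the tree's `realize` by structural induction, now
carrying the pressure bound — top two-state wave from PTS, whose certificate `certOfSplit` is trace
free because `q = 0` and `str` is trace free; children re-boxed by `placed`, which preserves sup
bounds of `prC`) the pressureless laminate of PL, and use Cor. 16 (`Laminate.sub_norm_vel_sq_le_var`).
[cite: ChoffrutSzekelyhidi2014, Prop. 6, Cor. 16] -/
theorem stub_pressurelessPacket :
    (∀ (r : ℝ) (w : State (Fin 3)) (ε : ℝ), w ∈ HighDim.U r → 0 < ε →
      ∃ r' : ℝ, r - ε < r' ∧ r' < r ∧ 0 ≤ r' ∧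
        ∃ T : Laminate (Fin 3), T.IsValid (HighDim.U r) ∧ T.bary = w ∧ T.AllAtoms (· ∈ K r') ∧
          @Laminate.rec (Fin 3) (fun _ => Prop) (fun _ => True)
            (fun _ _ q _ _ ihl ihr => q = 0 ∧ ihl ∧ ihr) T) →
    (∀ (c : WaveCert (Fin 3)), ‖c.η‖ = 1 → c.S.trace = 0 → ∀ (i₀ : Fin 3) (t : ℝ), 0 ≤ t → t ≤ 1 →
      ∀ (ε δ : ℝ), 0 < ε → 0 < δ →
        ∃ φ : Ed (Fin 3) → ℝ, ContDiff ℝ ∞ φ ∧ HasCompactSupport φ ∧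
          tsupport φ ⊆ refCube (houseR i₀ c.η) ∧
          (∀ x, ∃ θ ∈ Icc (-(1 - t)) t, ‖c.field φ x - θ • c.dir‖ ≤ δ) ∧
          (∀ x, |∑ m, c.strS φ m m x| ≤ δ) ∧
          ∃ Al Ar : Set (Ed (Fin 3)), IsOpen Al ∧ IsOpen Ar ∧ Al ⊆ refCube (houseR i₀ c.η) ∧
            Ar ⊆ refCube (houseR i₀ c.η) ∧ Disjoint Al Ar ∧
            (∀ x ∈ Al, c.field φ x = (-(1 - t)) • c.dir) ∧ (∀ x ∈ Ar, c.field φ x = t • c.dir) ∧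
            t - ε ≤ volume.real Al ∧ (1 - t) - ε ≤ volume.real Ar) →
    (∀ (r : ℝ) (w : State (Fin 3)) (ε δ : ℝ), w ∈ HighDim.U r → 0 < ε → 0 < δ →
      ∃ (F : Ed (Fin 3) ≃ₗᵢ[ℝ] Ed (Fin 3)) (P : Packet (Fin 3)), P.SuppIn (refCube F) ∧
        (∀ x, w + P.field x ∈ HighDim.U r) ∧
        r - ‖vel w‖ ^ 2 - ε ≤ ∫ x, ‖P.field x‖ ^ 2 ∧
        ∀ x, |P.prC x| ≤ δ) := by
  intro h₁ h₂ r w ε δ hw hε hδ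
  have hUo : IsRelOpen (HighDim.U (d := Fin 3) r) :=
    (HighDim.relaxedFamily (d := Fin 3) (Fintype.card_fin 3).ge).isRelOpen r
  have hUA : HighDim.U (d := Fin 3) r ⊆ Adm := fun w hw => hw.1
  obtain ⟨r', hr1, _, _, T, hT, hb, hK, hT0⟩ := h₁ r w (ε / 2) hw (half_pos hε)
  obtain ⟨P, hsupp, hPU, hgain, hpr⟩ :=
    pressurelessPacket_realize h₂ 0 hUo hUA T hT hT0 (half_pos hε) hδ
  have hvar := Laminate.sub_norm_vel_sq_le_var hT.weightsIn hK
  subst hb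
  exact ⟨T.frame 0, P, hsupp, hPU, by linarith, hpr⟩

end Summit.AnomalousDissipation.AnomalousDissipation.Theorems
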